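import Literature.AlgebraicGeometry.Motives.MumfordTateGroupOfOrientationVersusHodgeGroup
import HarnessLib

/-!
# `Hg(V_{Λ′})(ℂ) ≤ Hg(V_Λ)(ℂ) ⟺ U_{p_{Λ′}} ≤ U_{p_Λ}` on `𝒢 = Gal(L/ℚ)` — the Hodge-group half of (V.D.4) as an order statement in
# Green–Griffiths–Kerr's `𝒢`-language (`U_p = span{2p(g·) − n}`, Shimura's `T(φ − φρ)`), and `Hg ≤ Hg ⟹ 𝓡 ≤ 𝓡`

[topic AlgebraicGeometry/Motives]

Layer `Literature/AlgebraicGeometry/Motives`, lane `lit-hodgefound` (Track 2 foundations library; seat `lit-hodgefound-p02`, gen 27,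
row g27-#14).  THEOREMS ONLY (no definition, no named fact; net debt `0`).  The Hodge-group companion of g27-#9 §1
(`Motives/MumfordTateGroupOfOrientationQuestionVA10`: `MT(V_{Λ′})(ℂ) ≤ MT(V_Λ)(ℂ) ⟺ W_{p′} ≤ W_p` on `𝒢`): the modules
`U = antiDegSpan` of g25-#1 `NumberTheory/ComplexMultiplication/OrientedTypeRank` transport along equivariant maps, along bijections
intertwining two actions (`Hom_ℚ(K,L) ≃ Hom(K,ℂ)`, `Gal(L/ℚ)` versus `Aut(ℂ)`: the tree's `algHomEquivRingHomOfNormal` and its two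
intertwining lemmas of `CMTypeDictionaryGroupLevel`), and along group isomorphisms; with g27-#6
(`Hg ≤ Hg ⟺ U ≤ U` over `Aut(ℂ)`) and g27-#10 (`Hg ≤ Hg ⟹ MT ≤ MT`, weights `≠ 0`).

THE PRINTS.  GGK [GreenGriffithsKerr2012] (V.A.7) p. 157 (the module on `𝒢`), (V.D.4)–(V.D.6) pp. 164–165 (`M_φ`, `dim M_φ = 𝓡 − 1`); G. Shimura
[Shimura1998] §32.7 («determined independently of the choice of `M`»), §32.10 (`T(φ − φρ)`).

WHAT IS PROVED.
* §1 (group level) `antiDegVec_comp`, **`antiDegSpan_comp`** (equivariant pullback), **`antiDegSpan_comp_equiv_eq_map`** (a bijection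
  intertwining two actions), `antiDegSpan_comp_mulEquiv`, `antiDegSpan_comp_mulEquiv_le_iff`.
* §2 (orientations; `L ⊇ j(K)` normal) **`antiDegSpan_embDeg_eq_map`**, `antiDegSpan_embDeg_le_iff`, `antiDegSpan_galoisDeg_eq_map`,
  **`antiDegSpan_galoisDeg_le_iff`** (`U_{p′} ≤ U_p` on `𝒢` ⟺ `U′ ≤ U` over `Aut(ℂ)`),
  **`hodgeGroupBaseChange_complex_ofOrientation_le_iff_antiDegSpan_galoisDeg_le`**, `hodgeGroupBaseChange_complex_ofOrientation_eq_iff_antiDegSpan_galoisDeg_eq`,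
  **`kubotaRank_le_of_hodgeGroupBaseChange_complex_ofOrientation_le`** (any `K`, weights `≠ 0`), `mtRank_le_of_hodgeGroupBaseChange_complex_ofOrientation_le`.

HONEST SCOPE.  Order statements between point groups over `ℂ` inside `GL(ℂ ⊗ F)`; transfers are module identities, no new objects.

## References
* [GreenGriffithsKerr2012] M. Green, P. Griffiths, M. Kerr, *Mumford–Tate Groups and Domains: Their Geometry and Arithmetic*, Ann. of
  Math. Stud. 183 (2012): (V.A.7) p. 157, (V.D.4)–(V.D.6) pp. 164–165.
* [Shimura1998] G. Shimura, *Abelian Varieties with Complex Multiplication and Modular Functions* (1998), §32.7, §32.10.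
-/

noncomputable section

open scoped TensorProduct Classical Pointwise
open Module NumberField

/-! ## §1 Transport of `U = antiDegSpan` -/

namespace Literature.NumberTheory.ComplexMultiplication

section Pullback

variable {G : Type*} [Group G] {E E' : Type*} [MulAction G E] [MulAction G E']

/-- `u_g(δ′ ∘ π) = u_g(δ′) ∘ π` for an equivariant `π`. [cite: GreenGriffithsKerr2012, (V.A.7) p. 157] -/
theorem antiDegVec_comp (π : E → E') (hπ : ∀ (g : G) (x : E), π (g • x) = g • π x) (δ' : E' → ℤ) (n : ℤ) (g : G) :
    antiDegVec (δ' ∘ π) n g = antiDegVec δ' n g ∘ π := by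
  funext x
  simp only [antiDegVec, Function.comp_apply, degTranslate_apply, hπ]

/-- **`U_{δ′ ∘ π} = π^* U_{δ′}`** for an equivariant `π` (the `U`-companion of p02's `degSpan_comp`). [cite: GreenGriffithsKerr2012, (V.A.7) p. 157] -/
theorem antiDegSpan_comp (π : E → E') (hπ : ∀ (g : G) (x : E), π (g • x) = g • π x) (n : ℤ) (δ' : E' → ℤ) :
    antiDegSpan G n (δ' ∘ π) = (antiDegSpan G n δ').map (LinearMap.funLeft ℚ ℚ π) := by
  rw [antiDegSpan, antiDegSpan, Submodule.map_span]
  congr 1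
  ext f
  constructor
  · rintro ⟨g, rfl⟩
    exact ⟨antiDegVec δ' n g, ⟨g, rfl⟩, (antiDegVec_comp π hπ δ' n g).symm⟩
  · rintro ⟨_, ⟨g, rfl⟩, rfl⟩
    exact ⟨g, antiDegVec_comp π hπ δ' n g⟩

end Pullback

/-- **Transport of `U` along a bijection intertwining two actions** (`e(σ•x) = τ•e(x)` with `σ ↔ τ` surjective both ways, e.g.
`Hom_ℚ(K,L) ≃ Hom(K,ℂ)` for `Gal(L/ℚ)` versus `Aut(ℂ)`): `U_{δ′ ∘ e}` over `G` is `e^* U_{δ′}` over `G′`. [cite: Shimura1998, §32.7] [cite: GreenGriffithsKerr2012, (V.A.7) p. 157] -/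
theorem antiDegSpan_comp_equiv_eq_map {G G' : Type*} [Group G] [Group G'] {E E' : Type*} [MulAction G E] [MulAction G' E']
    (e : E ≃ E') (hG : ∀ σ : G, ∃ τ : G', ∀ x, e (σ • x) = τ • e x) (hG' : ∀ τ : G', ∃ σ : G, ∀ x, e (σ • x) = τ • e x)
    (n : ℤ) (δ' : E' → ℤ) :
    antiDegSpan G n (δ' ∘ e) =
      (antiDegSpan G' n δ').map ((LinearEquiv.funCongrLeft ℚ ℚ e : (E' → ℚ) ≃ₗ[ℚ] (E → ℚ)) : (E' → ℚ) →ₗ[ℚ] (E → ℚ)) := by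
  rw [antiDegSpan, antiDegSpan, Submodule.map_span]
  congr 1
  ext f
  constructor
  · rintro ⟨σ, rfl⟩
    obtain ⟨τ, hτ⟩ := hG σ
    refine ⟨antiDegVec δ' n τ, ⟨τ, rfl⟩, funext fun x => ?_⟩
    show antiDegVec δ' n τ (e x) = antiDegVec (δ' ∘ e) n σ x
    simp only [antiDegVec, degTranslate_apply, Function.comp_apply, hτ]
  · rintro ⟨_, ⟨τ, rfl⟩, rfl⟩
    obtain ⟨σ, hσ⟩ := hG' τ
    refine ⟨σ, funext fun x => ?_⟩
    show antiDegVec (δ' ∘ e) n σ x = antiDegVec δ' n τ (e x)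
    simp only [antiDegVec, degTranslate_apply, Function.comp_apply, hσ]

/-- **Transport of `U` along a group isomorphism** (left regular actions). [cite: GreenGriffithsKerr2012, (V.A.7) p. 157] -/
theorem antiDegSpan_comp_mulEquiv {G G' : Type*} [Group G] [Group G'] (e : G ≃* G') (n : ℤ) (p' : G' → ℤ) :
    antiDegSpan G n (p' ∘ e) =
      (antiDegSpan G' n p').map ((LinearEquiv.funCongrLeft ℚ ℚ e.toEquiv : (G' → ℚ) ≃ₗ[ℚ] (G → ℚ)) : (G' → ℚ) →ₗ[ℚ] (G → ℚ)) :=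
  antiDegSpan_comp_equiv_eq_map (G := G) (G' := G') e.toEquiv (fun σ => ⟨e σ, fun x => map_mul e σ x⟩)
    (fun τ => ⟨e.symm τ, fun x => by
      show e (e.symm τ * x) = τ * e x
      rw [map_mul, MulEquiv.apply_symm_apply]⟩) n p'

/-- … so inclusions of the modules `U` transport along `e`. [cite: GreenGriffithsKerr2012, (V.A.7) p. 157] -/
theorem antiDegSpan_comp_mulEquiv_le_iff {G G' : Type*} [Group G] [Group G'] (e : G ≃* G') (n n' : ℤ) (p' q' : G' → ℤ) :
    antiDegSpan G n' (p' ∘ e) ≤ antiDegSpan G n (q' ∘ e) ↔ antiDegSpan G' n' p' ≤ antiDegSpan G' n q' := by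
  rw [antiDegSpan_comp_mulEquiv, antiDegSpan_comp_mulEquiv]
  exact Submodule.map_le_map_iff_of_injective (LinearEquiv.injective _) _ _

end Literature.NumberTheory.ComplexMultiplication

/-! ## §2 The Hodge group in `𝒢`-language -/

namespace Literature.AlgebraicGeometry.Motives

namespace HodgeStructure

open Literature.NumberTheory.ComplexMultiplication

section Transfer

variable {K : Type} [Field K] [NumberField K] {n n' : ℤ} (Λ : Orientation K n) (Λ' : Orientation K n')
  {L : Type} [Field L] [NumberField L] [Normal ℚ L] (j : K →ₐ[ℚ] L) (ι : L →+* ℂ)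

/-- **`U` on `Hom_ℚ(K,L)` (over `Gal(L/ℚ)`) is the pullback of `U` on `Hom(K,ℂ)` (over `Aut(ℂ)`)** along `ψ ↦ ι ∘ ψ` — the `U`-companion of
g26-#1's `degSpan_embDeg_eq_map` (same linear isomorphism). [cite: Shimura1998, §32.7] [cite: GreenGriffithsKerr2012, (V.A.7) p. 157] -/
theorem antiDegSpan_embDeg_eq_map :
    antiDegSpan (L ≃ₐ[ℚ] L) n (Λ.embDeg ι) =
      (antiDegSpan (ℂ ≃+* ℂ) n Λ.deg).map
        ((LinearEquiv.funCongrLeft ℚ ℚ (algHomEquivRingHomOfNormal j ι) :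
            ((K →+* ℂ) → ℚ) ≃ₗ[ℚ] ((K →ₐ[ℚ] L) → ℚ)) : ((K →+* ℂ) → ℚ) →ₗ[ℚ] ((K →ₐ[ℚ] L) → ℚ)) := by
  have h : Λ.embDeg ι = Λ.deg ∘ ⇑(algHomEquivRingHomOfNormal j ι) := rfl
  rw [h]
  exact antiDegSpan_comp_equiv_eq_map (G := L ≃ₐ[ℚ] L) (G' := ℂ ≃+* ℂ) (algHomEquivRingHomOfNormal j ι)
    (exists_ringEquiv_forall_algHomEquivRingHomOfNormal_smul j ι) (exists_algEquiv_forall_algHomEquivRingHomOfNormal_smul j ι) n Λ.deg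

include j in
/-- `U_{Λ′} ≤ U_Λ` on `Hom_ℚ(K,L)` iff on `Hom(K,ℂ)`. [cite: Shimura1998, §32.7] -/
theorem antiDegSpan_embDeg_le_iff :
    antiDegSpan (L ≃ₐ[ℚ] L) n' (Λ'.embDeg ι) ≤ antiDegSpan (L ≃ₐ[ℚ] L) n (Λ.embDeg ι) ↔
      antiDegSpan (ℂ ≃+* ℂ) n' Λ'.deg ≤ antiDegSpan (ℂ ≃+* ℂ) n Λ.deg := by
  rw [antiDegSpan_embDeg_eq_map Λ' j ι, antiDegSpan_embDeg_eq_map Λ j ι]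
  exact Submodule.map_le_map_iff_of_injective (LinearEquiv.injective _) _ _

omit [Normal ℚ L] in
/-- `U_p` on `𝒢 = Gal(L/ℚ)` is the pullback of `U` on `Hom_ℚ(K,L)` along the orbit map `g ↦ g • j`. [cite: GreenGriffithsKerr2012, (V.A.3) p. 156 and (V.A.7) p. 157] -/
theorem antiDegSpan_galoisDeg_eq_map :
    antiDegSpan (L ≃ₐ[ℚ] L) n (Λ.galoisDeg j ι) =
      (antiDegSpan (L ≃ₐ[ℚ] L) n (Λ.embDeg ι)).map (LinearMap.funLeft ℚ ℚ fun g : L ≃ₐ[ℚ] L => g • j) := by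
  have h : Λ.galoisDeg j ι = Λ.embDeg ι ∘ fun g : L ≃ₐ[ℚ] L => g • j := rfl
  rw [h]
  exact antiDegSpan_comp (G := L ≃ₐ[ℚ] L) (fun g : L ≃ₐ[ℚ] L => g • j) (fun g x => mul_smul g x j) n (Λ.embDeg ι)

/-- **`U_{p_{Λ′}} ≤ U_{p_Λ}` on `𝒢` ⟺ `U_{Λ′} ≤ U_Λ` over `Aut(ℂ)`** (`L ⊇ j(K)` normal). [cite: GreenGriffithsKerr2012, (V.A.7) p. 157] [cite: Shimura1998, §32.7] -/
theorem antiDegSpan_galoisDeg_le_iff :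
    antiDegSpan (L ≃ₐ[ℚ] L) n' (Λ'.galoisDeg j ι) ≤ antiDegSpan (L ≃ₐ[ℚ] L) n (Λ.galoisDeg j ι) ↔
      antiDegSpan (ℂ ≃+* ℂ) n' Λ'.deg ≤ antiDegSpan (ℂ ≃+* ℂ) n Λ.deg := by
  rw [antiDegSpan_galoisDeg_eq_map Λ' j ι, antiDegSpan_galoisDeg_eq_map Λ j ι,
    Submodule.map_le_map_iff_of_injective
      (LinearMap.funLeft_injective_of_surjective ℚ ℚ _ (MulAction.surjective_smul (L ≃ₐ[ℚ] L) j)),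
    antiDegSpan_embDeg_le_iff Λ Λ' j ι]

variable [HodgeTensorFacts.{0, 0}]

/-- **The Hodge-group half of (V.D.4) as an order statement in `𝒢`-language: `Hg(V_{Λ′})(ℂ) ≤ Hg(V_Λ)(ℂ) ⟺ U_{p_{Λ′}} ≤ U_{p_Λ}`**
(`U_p = span{2p(g·) − n}` on `𝒢 = Gal(L/ℚ)`; g27-#6 over `Aut(ℂ)` + the transfer). [cite: GreenGriffithsKerr2012, (V.D.4)–(V.D.6) pp. 164–165 and (V.A.7) p. 157]
[cite: Shimura1998, §32.10] -/
theorem hodgeGroupBaseChange_complex_ofOrientation_le_iff_antiDegSpan_galoisDeg_le :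
    (ofOrientation Λ').hodgeGroupBaseChange ℂ ≤ (ofOrientation Λ).hodgeGroupBaseChange ℂ ↔
      antiDegSpan (L ≃ₐ[ℚ] L) n' (Λ'.galoisDeg j ι) ≤ antiDegSpan (L ≃ₐ[ℚ] L) n (Λ.galoisDeg j ι) := by
  rw [hodgeGroupBaseChange_complex_ofOrientation_le_iff_antiDegSpan_le, antiDegSpan_galoisDeg_le_iff Λ Λ' j ι]

/-- **`Hg(V_Λ)(ℂ) = Hg(V_{Λ′})(ℂ) ⟺ U_{p_Λ} = U_{p_{Λ′}}` on `𝒢`.** [cite: GreenGriffithsKerr2012, (V.D.4)–(V.D.6) pp. 164–165] [cite: Shimura1998, §32.10] -/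
theorem hodgeGroupBaseChange_complex_ofOrientation_eq_iff_antiDegSpan_galoisDeg_eq :
    (ofOrientation Λ).hodgeGroupBaseChange ℂ = (ofOrientation Λ').hodgeGroupBaseChange ℂ ↔
      antiDegSpan (L ≃ₐ[ℚ] L) n (Λ.galoisDeg j ι) = antiDegSpan (L ≃ₐ[ℚ] L) n' (Λ'.galoisDeg j ι) := by
  rw [le_antisymm_iff, le_antisymm_iff, hodgeGroupBaseChange_complex_ofOrientation_le_iff_antiDegSpan_galoisDeg_le Λ' Λ j ι,
    hodgeGroupBaseChange_complex_ofOrientation_le_iff_antiDegSpan_galoisDeg_le Λ Λ' j ι]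

include j ι in
/-- **`Hg(V_{Λ′})(ℂ) ≤ Hg(V_Λ)(ℂ) ⟹ 𝓡(Λ′) ≤ 𝓡(Λ)`** for orientations of non-zero weights of any number field (g27-#10: `Hg ≤ Hg ⟹ MT ≤ MT`;
g27-#9: `MT ≤ MT ⟹ 𝓡 ≤ 𝓡`). [cite: GreenGriffithsKerr2012, (V.D.5)–(V.D.6) pp. 164–165] -/
theorem kubotaRank_le_of_hodgeGroupBaseChange_complex_ofOrientation_le (hn : n ≠ 0) (hn' : n' ≠ 0)
    (h : (ofOrientation Λ').hodgeGroupBaseChange ℂ ≤ (ofOrientation Λ).hodgeGroupBaseChange ℂ) :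
    Λ'.kubotaRank j ι ≤ Λ.kubotaRank j ι :=
  kubotaRank_le_of_mumfordTateGroupBaseChange_complex_ofOrientation_le Λ Λ' j ι
    (mumfordTateGroupBaseChange_complex_ofOrientation_le_of_hodgeGroupBaseChange_le Λ Λ' hn hn' h)

omit [NumberField L] [Normal ℚ L] in
/-- … and `dim M_φ̃(V_{Λ′}) ≤ dim M_φ̃(V_Λ)` (no auxiliary field). [cite: GreenGriffithsKerr2012, (V.D.5)–(V.D.6) pp. 164–165] -/
theorem mtRank_le_of_hodgeGroupBaseChange_complex_ofOrientation_le (hn : n ≠ 0) (hn' : n' ≠ 0)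
    (h : (ofOrientation Λ').hodgeGroupBaseChange ℂ ≤ (ofOrientation Λ).hodgeGroupBaseChange ℂ) :
    (ofOrientation Λ').mtRank ≤ (ofOrientation Λ).mtRank :=
  mtRank_le_of_mumfordTateGroupBaseChange_complex_ofOrientation_le Λ Λ'
    (mumfordTateGroupBaseChange_complex_ofOrientation_le_of_hodgeGroupBaseChange_le Λ Λ' hn hn' h)

end Transfer

end HodgeStructure

end Literature.AlgebraicGeometry.Motives
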